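import Summits.NavierStokesRegularity.FluidComputer.PartialRegularityFace
import Summits.NavierStokesRegularity.FluidComputer.PressureFace
import Literature.Analysis.FluidPDE.NSCriticalClosureBesovHolds
import HarnessLib

/-!
# Fluid computer — the level dictionary, BESOV FACE (L39): the critical Besov norms `Ḃ^{-1+3/r}_{r,q}`,
# `3 < r, q < ∞`, are unbounded on every terminal window (Gallagher–Koch–Planchon)

HONEST FRAMING (cell `pub-fluidc`, verbatim): *low prior, high value-of-information experiment on Tao's
machine paradigm; NOT a claim that NS blows up.* Theorem side of the cell; nothing here is evidence of blow-up.
L27 (Seregin) says `‖u(t)‖_{L³} → ∞`; L29 puts it in level currency. The scale of critical spaces continues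
BELOW `L³`: `L³ ⊂ Ḃ^{-1+3/r}_{r,q} ⊂ Ḃ^{-1}_{∞,∞}` (`3 < r, q < ∞`), and the continuation criterion in these
larger spaces — Gallagher–Koch–Planchon, Comm. Math. Phys. 343 (2016), Thm. 1; the rigidity argument of Wang–Zhang —
is PROVED in the tree for classical Leray–Hopf solutions, with no decay hypothesis, in the pointwise form
`regular_at_final_time_of_classical_besov_bounded_visc`: a bound on `sup_{t<T} ‖u(t)‖_{Ḃ^{-1+3/r}_{r,q}}` makes EVERY
point of the final slice regular. Read at the focus of L33′ it gives, for every maximal smooth solution `(u, p)`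
of the unforced Navier–Stokes system on `ℝ³ × [0, T)` (`ν > 0`) which is Leray–Hopf from `u 0`, and every family
`U t` of tempered distributions representing the slices `u t` (`IsDistributionOf`; e.g. the `L²` classes):

* `iSup_eHomBesovNorm_eq_top` (**L39 — THE CRITICAL BESOV NORMS BLOW UP**): for all `3 < r < ∞`, `3 < q < ∞`,
  `sup_{t ∈ [0,T)} ‖U t‖_{Ḃ^{-1+3/r}_{r,q}} = ∞`;
* `iSup_eHomBesovNorm_window_eq_top` (**L39′ — ON EVERY TERMINAL WINDOW**): `sup_{t ∈ [t₀,T)} ‖U t‖ = ∞` for every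
  `t₀ < T` (restart at an a.e.-good time; the focus survives, `PressureFace.unbounded_translate`), i.e.
  `limsup_{t↑T} ‖u(t)‖_{Ḃ^{-1+3/r}_{r,q}} = ∞`;
* `frequently_lt_eHomBesovNorm` (the same as a `∃ᶠ` statement along `t ↑ T`).

LEVEL CURRENCY (this is why the face belongs to the dictionary): by definition
`‖U‖_{Ḃ^{-1+3/r}_{r,q}} = ‖(2^{j(3/r − 1)} ‖Δ̇_j u‖_{L^r})_{j∈ℤ}‖_{ℓ^q}` (`eHomBesovNorm`, the tree's Littlewood–Paley
blocks): the row `2^{−j(1−3/r)} ‖Δ̇_j u(t)‖_r`, DAMPED by the negative power `−(1 − 3/r)` of the wavenumber and summed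
in `ℓ^q` with `q` as large as desired (but finite), is unbounded as `t ↑ T`. By block interpolation
`‖Δ̇_j u‖_r ≤ s_j^{1−2/r} a_j^{2/r}` this row is below the mixed rows of L29; the exponent pair `(r, q) = (∞, ∞)` —
the Besov space `Ḃ^{-1}_{∞,∞}` of the Cheskidov–Shvydkoy jump L4 — is NOT covered (open problem). Scale-invariant,
no `ν`, no rate. Necessity only. 0 sorry; no new definitions, no named facts.

## References

* I. Gallagher, G. Koch, F. Planchon, Comm. Math. Phys. 343 (2016) 39–82, Thm. 1. [GKP2016]
* W. Wang, Z. Zhang, Sci. China Math. 60 (2017) 637–650, Thm. 1.2 and §4. [WangZhang2016]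
* H. Bahouri, J.-Y. Chemin, R. Danchin, *Fourier Analysis and Nonlinear PDE*, Springer 2011, Def. 2.15.
  [BahouriCheminDanchin2011]
-/

noncomputable section

open MeasureTheory Set Function Filter Topology Metric
open scoped ENNReal NNReal SchwartzMap
open Literature.Analysis.FluidPDE Literature.Analysis.FunctionSpaces
open Summit.NavierStokesRegularity.FluidComputer.LocalisationFace
open Summit.NavierStokesRegularity.FluidComputer.PartialRegularityFace
open Summit.NavierStokesRegularity.FluidComputer.PressureFace

namespace Summit.NavierStokesRegularity.FluidComputer.BesovFace

/-! ## L39: the critical Besov norms blow up -/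

/-- **L39 — THE CRITICAL BESOV NORMS `Ḃ^{-1+3/r}_{r,q}` (`3 < r, q < ∞`) BLOW UP.** For `ν > 0`, `T > 0`, every
maximal smooth solution `(u, p)` of the unforced Navier–Stokes system on `ℝ³ × [0, T)` which is Leray–Hopf from
`u 0`, and every family of tempered distributions `U t` representing the slices `u t` on `[0, T)`:
`sup_{t ∈ [0,T)} ‖U t‖_{Ḃ^{-1+3/r}_{r,q}} = ∞`. Otherwise every point `(T, x₀)` would be regular
(`regular_at_final_time_of_classical_besov_bounded_visc`, PROVED in the tree), contradicting the singular point of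
L33′ (`PartialRegularityFace.isBackwardSingularPoint_of_unbounded`). [cite: GKP2016, Thm. 1]
[cite: WangZhang2016, Thm. 1.2 and §4] -/
theorem iSup_eHomBesovNorm_eq_top {ν T : ℝ} (hν : 0 < ν) (hT : 0 < T)
    {u : ℝ → EuclideanSpace ℝ (Fin 3) → EuclideanSpace ℝ (Fin 3)} {p : ℝ → EuclideanSpace ℝ (Fin 3) → ℝ}
    (hmax : IsMaximalSmoothSolution ν 0 u p T) (hLH : IsLerayHopfOn T ν 0 (u 0) u)
    {U : ℝ → 𝓢'(EuclideanSpace ℝ (Fin 3), EuclideanSpace ℂ (Fin 3))}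
    (hU : ∀ t ∈ Ico 0 T, IsDistributionOf (u t) (U t))
    {r q : ℝ≥0∞} [Fact (1 ≤ r)] (hr3 : 3 < r) (hr : r < ⊤) (hq3 : 3 < q) (hq : q < ⊤) :
    (⨆ t ∈ Ico 0 T, eHomBesovNorm (-1 + 3 / r.toReal) r q (U t)) = ⊤ := by
  by_contra hne
  obtain ⟨x₀, hsing⟩ := exists_singularPoint hν hT hmax hLH
  obtain ⟨ρ, hρ, hfin⟩ := regular_at_final_time_of_classical_besov_bounded_visc hν hr3 hr hq3 hq hT hmax.1
    hLH hU (lt_top_iff_ne_top.2 hne) x₀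
  exact hfin.ne (isBackwardSingularPoint_of_unbounded hmax.1 hsing ρ hρ)

/-- **L39′ — ON EVERY TERMINAL WINDOW.** With the same data, for every `t₀ ∈ [0, T)`:
`sup_{t ∈ [t₀,T)} ‖U t‖_{Ḃ^{-1+3/r}_{r,q}} = ∞`, i.e. `limsup_{t↑T} ‖u(t)‖_{Ḃ^{-1+3/r}_{r,q}} = ∞`. Proof: restart at an
a.e.-good time `s ∈ (t₀, T)` (`IsLerayHopfOn.exists_isLerayHopfOn_restart_Ioo`); the translate `u(· + s)` is
classical on `[0, T − s)`, Leray–Hopf from `u s`, represented by `U(· + s)`, and keeps the focus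
(`PressureFace.unbounded_translate`). [cite: GKP2016, Thm. 1] [cite: WangZhang2016, Thm. 1.2 and §4] -/
theorem iSup_eHomBesovNorm_window_eq_top {ν T : ℝ} (hν : 0 < ν) (hT : 0 < T)
    {u : ℝ → EuclideanSpace ℝ (Fin 3) → EuclideanSpace ℝ (Fin 3)} {p : ℝ → EuclideanSpace ℝ (Fin 3) → ℝ}
    (hmax : IsMaximalSmoothSolution ν 0 u p T) (hLH : IsLerayHopfOn T ν 0 (u 0) u)
    {U : ℝ → 𝓢'(EuclideanSpace ℝ (Fin 3), EuclideanSpace ℂ (Fin 3))}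
    (hU : ∀ t ∈ Ico 0 T, IsDistributionOf (u t) (U t))
    {r q : ℝ≥0∞} [Fact (1 ≤ r)] (hr3 : 3 < r) (hr : r < ⊤) (hq3 : 3 < q) (hq : q < ⊤)
    {t₀ : ℝ} (ht₀ : t₀ ∈ Ico 0 T) :
    (⨆ t ∈ Ico t₀ T, eHomBesovNorm (-1 + 3 / r.toReal) r q (U t)) = ⊤ := by
  by_contra hne
  obtain ⟨x₀, hsing⟩ := exists_singularPoint hν hT hmax hLH
  -- an a.e.-good restart time `s ∈ (t₀, T)`
  obtain ⟨s, hs, hLHs⟩ := hLH.exists_isLerayHopfOn_restart_Ioo hν.le ht₀.1 ht₀.2 le_rfl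
  have hs0 : 0 < s := ht₀.1.trans_lt hs.1
  have hTs : 0 < T - s := sub_pos.2 hs.2
  have hcl' : IsClassicalNSSolutionOn (Ico 0 (T - s)) ν 0 (fun t => u (t + s)) (fun t => p (t + s)) :=
    hmax.1.translate_Ico_zero hs0.le
  have hLH' : IsLerayHopfOn (T - s) ν 0 ((fun t => u (t + s)) 0) (fun t => u (t + s)) := by
    show IsLerayHopfOn (T - s) ν 0 (u (0 + s)) (fun t => u (t + s))
    rw [zero_add]
    exact hLHs
  have hU' : ∀ t ∈ Ico 0 (T - s), IsDistributionOf ((fun t => u (t + s)) t) (U (t + s)) :=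
    fun t ht => hU (t + s) ⟨by linarith [ht.1, hs0], by linarith [ht.2]⟩
  have hsup' : (⨆ t ∈ Ico 0 (T - s), eHomBesovNorm (-1 + 3 / r.toReal) r q (U (t + s))) < ⊤ := by
    refine lt_of_le_of_lt (iSup₂_le fun t ht => ?_) (lt_top_iff_ne_top.2 hne)
    have hts : t + s ∈ Ico t₀ T := ⟨by linarith [ht.1, hs.1], by linarith [ht.2]⟩
    exact le_iSup₂ (f := fun t (_ : t ∈ Ico t₀ T) => eHomBesovNorm (-1 + 3 / r.toReal) r q (U t)) (t + s) hts
  obtain ⟨ρ, hρ, hfin⟩ := regular_at_final_time_of_classical_besov_bounded_visc hν hr3 hr hq3 hq hTs hcl'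
    hLH' (U := fun t => U (t + s)) hU' hsup' x₀
  exact hfin.ne (isBackwardSingularPoint_of_unbounded hcl' (unbounded_translate ⟨hs0.le, hs.2⟩ hsing) ρ hρ)

/-- **L39′ along `t ↑ T`**: for every `M < ∞`, frequently as `t ↑ T`, `M < ‖U t‖_{Ḃ^{-1+3/r}_{r,q}}`.
[cite: GKP2016, Thm. 1] -/
theorem frequently_lt_eHomBesovNorm {ν T : ℝ} (hν : 0 < ν) (hT : 0 < T)
    {u : ℝ → EuclideanSpace ℝ (Fin 3) → EuclideanSpace ℝ (Fin 3)} {p : ℝ → EuclideanSpace ℝ (Fin 3) → ℝ}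
    (hmax : IsMaximalSmoothSolution ν 0 u p T) (hLH : IsLerayHopfOn T ν 0 (u 0) u)
    {U : ℝ → 𝓢'(EuclideanSpace ℝ (Fin 3), EuclideanSpace ℂ (Fin 3))}
    (hU : ∀ t ∈ Ico 0 T, IsDistributionOf (u t) (U t))
    {r q : ℝ≥0∞} [Fact (1 ≤ r)] (hr3 : 3 < r) (hr : r < ⊤) (hq3 : 3 < q) (hq : q < ⊤)
    {M : ℝ≥0∞} (hM : M < ⊤) :
    ∃ᶠ t in 𝓝[<] T, M < eHomBesovNorm (-1 + 3 / r.toReal) r q (U t) := by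
  rw [(nhdsLT_basis T).frequently_iff]
  intro a ha
  have ha2 : (a + T) / 2 < T := by linarith
  have htop := iSup_eHomBesovNorm_window_eq_top hν hT hmax hLH hU hr3 hr hq3 hq
    (t₀ := max ((a + T) / 2) 0) ⟨le_max_right _ _, max_lt ha2 hT⟩
  have hlt : M < ⨆ t ∈ Ico (max ((a + T) / 2) 0) T, eHomBesovNorm (-1 + 3 / r.toReal) r q (U t) := by
    rw [htop]; exact hM
  rw [lt_iSup_iff] at hlt
  obtain ⟨t, ht⟩ := hlt
  rw [lt_iSup_iff] at ht
  obtain ⟨htI, hMt⟩ := ht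
  have hat : a < t := by
    have h1 : (a + T) / 2 ≤ t := (le_max_left _ _).trans htI.1
    linarith
  exact ⟨t, ⟨hat, htI.2⟩, hMt⟩

/-- **The `L²` representatives**: the slices of the class lie in `L²`, so the Mathlib tempered distributions of
their `L²` classes represent them (`isDistributionOf_toTemperedDistribution`) — the Besov face is never vacuous.
[cite: BahouriCheminDanchin2011, §1.2 (L^p ⊂ 𝓢')] -/
theorem exists_representatives {ν T : ℝ}
    {u : ℝ → EuclideanSpace ℝ (Fin 3) → EuclideanSpace ℝ (Fin 3)}
    (hLH : IsLerayHopfOn T ν 0 (u 0) u) :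
    ∃ U : ℝ → 𝓢'(EuclideanSpace ℝ (Fin 3), EuclideanSpace ℂ (Fin 3)),
      ∀ t ∈ Ico 0 T, IsDistributionOf (u t) (U t) := by
  classical
  refine ⟨fun t => if ht : t ∈ Icc 0 T then
      Lp.toTemperedDistribution ((memLp_complexify_comp (hLH.memLp t ht)).toLp _) else 0, fun t ht => ?_⟩
  have ht' : t ∈ Icc 0 T := ⟨ht.1, ht.2.le⟩
  simp only [dif_pos ht']
  exact isDistributionOf_toTemperedDistribution (hLH.memLp t ht')

/-- **THE BESOV FACE, ASSEMBLED** (representatives exist; on every terminal window every critical Besov norm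
`Ḃ^{-1+3/r}_{r,q}`, `3 < r, q < ∞`, of any representing family is unbounded). [cite: GKP2016, Thm. 1] -/
theorem besov_face {ν T : ℝ} (hν : 0 < ν) (hT : 0 < T)
    {u : ℝ → EuclideanSpace ℝ (Fin 3) → EuclideanSpace ℝ (Fin 3)} {p : ℝ → EuclideanSpace ℝ (Fin 3) → ℝ}
    (hmax : IsMaximalSmoothSolution ν 0 u p T) (hLH : IsLerayHopfOn T ν 0 (u 0) u) :
    (∃ U : ℝ → 𝓢'(EuclideanSpace ℝ (Fin 3), EuclideanSpace ℂ (Fin 3)),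
        ∀ t ∈ Ico 0 T, IsDistributionOf (u t) (U t)) ∧
      ∀ (U : ℝ → 𝓢'(EuclideanSpace ℝ (Fin 3), EuclideanSpace ℂ (Fin 3))),
        (∀ t ∈ Ico 0 T, IsDistributionOf (u t) (U t)) →
        ∀ (r q : ℝ≥0∞) [Fact (1 ≤ r)], 3 < r → r < ⊤ → 3 < q → q < ⊤ →
          ∀ t₀ ∈ Ico 0 T, (⨆ t ∈ Ico t₀ T, eHomBesovNorm (-1 + 3 / r.toReal) r q (U t)) = ⊤ :=
  ⟨exists_representatives hLH, fun _ hU _ _ _ hr3 hr hq3 hq _ ht₀ =>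
    iSup_eHomBesovNorm_window_eq_top hν hT hmax hLH hU hr3 hr hq3 hq ht₀⟩

end Summit.NavierStokesRegularity.FluidComputer.BesovFace

end
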